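import Literature.MathematicalPhysics.QuantumManyBody.PeriodicBoseGas
import Literature.MathematicalPhysics.QuantumManyBody.BoseGasStructureFactor
import Literature.MathematicalPhysics.QuantumManyBody.PeriodicBoseGasThm31
import Literature.MathematicalPhysics.QuantumManyBody.PeriodicBoseGasImpurityTranslation
import Literature.MathematicalPhysics.QuantumManyBody.TorusFockSectorInteraction
import HarnessLib

/-!
# Line Sketch (crux stmt-AtomisticToContinuum-18512 `ModePriceIntegrable`) — g-notch infrastructure and the status of stub F

**Verdict: `stub-blocked`.** The g-notched stub (`t = 8πa(v)`) SURVIVES the adversarial pass (§A: no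
trial family gains more than `O(ρ)`; every leading-order gain is exactly cancelled and the residual
margins — quantum pressure, LHY stiffness — are positive), and it is NOT provable from the tree or from
print: it is an `N`-uniform `O(1)` structure-factor bound for near-ground states of an interacting Bose
gas in the thermodynamic limit (§D). This file lands the sorry-free infrastructure of §B as helpers for
the line (`--supports`); the missing fact itself is NOT declared here (it is recorded, with the proved
reduction to the registered signature, in the item evidence `stub_gNotchedStructureFactor_BLOCKED.lean`).

## A. Adversarial pass (paper level: Bogoliubov with renormalised vertex + LHY; numbers)
Notation: `Q = ⟨|ρ̂_k|²⟩/L³`, `M_t = tQ`, `F_t = E + tρN - M_t`, `SWITCH(t) = E₀ + tρN - inf F_t =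
sup_Ψ [M_t(Ψ) - (E(Ψ) - E₀)]`; by `GNotch.secant_lower` every `δ`-near-minimiser has
`M_t(Φ) ≥ SWITCH(t) - δ`, so a witness is a trial family with `M_t - (E - E₀) ≫ ρ`.
* A1 density waves `n = ρ(1+h)`, `∫h = 0` (any profile, any amplitude): gain `tρ²|ĥ(k)|²/L³ =
  8πaρ²|ĥ(k)|²/L³`; LDA cost `4πaρ²∫h² + LHY·∫[(1+h)^{5/2}-1-(5/2)h] + gradient`, and Parseval
  `∫h² ≥ 2|ĥ(k)|²/L³` (equality iff `h = A cos(k·x+φ)`): at `t = 8πa` mean-field gain ≤ cost for EVERY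
  profile; residual margins `A²k²N/8` and `(e₀''-8πa)A²ρN/4 = 32√π·a√(ρa³)·A²ρN`
  (`e₀'' = 8πa(1 + (16/√π)√(ρa³))`). Response form: cost `R(k)|⟨ρ̂_k⟩|²/L³`, `R_Bog = 8πa + k²/(2ρ)`,
  `R(0⁺) = e₀''` (compressibility sum rule); CDW instability iff `R(k) < 8πa` for some `k ≥ 2π/L`; with
  `R - R_Bog = 8πa√(ρa³)φ(kξ)`, `φ(0) = 16/√π`, `φ` bounded, `R(k) - t < 0` forces
  `(kξ)² < 2‖φ‖√(ρa³) ≪ 1` where `φ ≈ φ(0) > 0`: no instability for small `ρa³` (wave 1's bare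
  `t = V₀ > e₀''` had `R(0⁺) < t`: extensive).
* A2 pair-squeezed `±k` (no mean wave): notched Bogoliubov block `[k²+ρg'](a†a+b†b) + ρg'(a†b†+ab) - tρ`,
  `g' = g_eff(k) - t`, bounded below iff `k² + 2ρg' ≥ 0` (= A1's condition), ground value
  `-(k²+ρg'-e'_k)`, `e'_k = √(k⁴+2ρg'k²)`, `S̃'(k) = k²/e'_k = (1+2ρg'/k²)^{-1/2}`. Ultra-IR
  (`(kξ)² ≲ (32/√π)√(ρa³)`): `g' = +128√π·a√(ρa³)` ⟹ `S̃' < 1`; IR/crossover: `|2ρg'|/k² ≤ ‖φ‖/K +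
  O(ρaR₀²)` ⟹ `S̃' = O(1)`; far UV `k² ≥ 64πaρ`: `|g_eff| ≤ ĝ(0) = 8πa` (`vf ≥ 0`) ⟹ `S̃' ≤ √2`
  whatever the sign of the over-notch `v̂(k) < 8πa`. `SWITCH ≈ e_k - e'_k ≤ 8πaρ + 2ρ|g'| = O(ρ)`,
  `M_t(Φ_t) = tρS̃' ≤ 8πaρ·√2`: `C₁ ≈ 36a` at this level.
* A3 fragmented `|N/2⟩_{k/2}|N/2⟩_{-k/2}`: `⟨|ρ̂_k|²⟩ ≈ N²/4`, gain `tρN/4 = 2πaρN` = exchange cost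
  `gρN/4` exactly; kinetic `k²N/4` + LHY tip it (it is the `A = 1` wave of A1). Phase imprints, boosts,
  one-phonon `ρ̂_kΨ₀`: gains `≤ tρ·O(1)`.
* A4 Kac criticality: `-tQ` is a mean-field (Kac) attraction of the phases `k·x_j`; `t = 8πa` is at
  relative distance `ε_c = (16/√π)√(ρa³)` below the `k→0` CDW threshold `e₀''`, but `S̃'_t(k)` equals
  `1` at `t = g_eff(k)` and diverges only at `t → R(k) = g_eff + k²/(2ρ)`; beyond-mean-field energy of
  the one collective mode `= e_k - e'_k = O(ρ)`. The ENERGY reformulation (`GNotch.secant_upper` with a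
  deeper notch `s = εt`, `ε < ε_c`) would need `SWITCH(t→t(1+ε)) ≤ εC₁ρ`, sub-LHY precision: harder
  than the structure-factor form, which is therefore the right missing fact (§D).
* A5 degenerate data: `a(v) = 0` ⟹ `t = 0`, `M ≡ 0`: PROVED (§3). Empty class / `inf F = ⊤`: no
  (`GNotch.constState`, `F(const) = C(N,2)∫v/L³ + ≤ 4t·C(N,2)/L³ < ∞`, §2). Large `δ`: `Φ = const` has
  `M = tρ` (`S = 1`, paper). Small `N`, `L < 2R₀`: excluded by `∀ᶠ N`. `m` enters only via `|k|`.
Rigour: a certified witness needs `E₀` from below to the witness' gain; LSSY Thm 2.4 / LHY lower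
bounds have EXTENSIVE errors, so only extensive violations (wave 1) are certifiable — and A1–A3 show the
g-notch has none. No `stub-false`.

## B. Proved here (rc 0, 0 sorry; all `[folklore]`)
`GNotch.exists_nearMin`; `GNotch.secant_lower` / `secant_upper` / `mode_le_of_deeper_notch` (the
concavity sandwich `SWITCH(t) - δ ≤ t·Q(Φ)`, `s·Q(Φ) ≤ SWITCH(t→t+s) + δ` in additive `ℝ≥0∞` form,
for `F_t = E + t·W`, `M_t = t·Q`, `Q + W = Qmax` = stubs N+A); `GNotch.constState`,
(inhabited for all `N`: `⟨constState N hL⟩`; the named `Nonempty` lemma is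
`BoundaryTransferWeak.Negative.nonempty_periodicTrialState`); `periodicEnergy_constState = C(N,2)·∫v·(L³)⁻¹`,
`notchTerm_le`, `notchedF_constState_ne_top` (near-minimisers with finite `F` exist); `mode_le_sq`
(`M ≤ (t/L³)N²`); §3 `stub_gNotchedStructureFactor_of_scatteringLength_eq_zero` (registered signature
+ `scatteringLength v = 0`). (The evidence copy of this file on the item also carries §4: the missing
fact `BoundedGNotchedStructureFactor` as a `def … : Prop` and the reduction
`gNotchedStructureFactor_of_bounded` to the registered signature with `C₁ = 8πaC + 1` — not landed here:
a conjecture is not a tree fact.)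

## C. Presearch / search record
presearch: N-uniform bound on S_N(k) of (near-)ground states of the dilute Bose gas → none
(`lit search --hybrid "uniform upper bound static structure factor ground state dilute Bose gas
thermodynamic limit"` → LSSY2005 pp 46–56 (BEC/GP limit only), Griffin1993, [corpus:book:griffin1995-
bose-einstein-condensation p.74] = Stringari1995 §2.2 (10) `S(q) ≤ √(m₁·χ/2)/N`, CONDITIONAL on the
static response; `lit galaxy search "static structure factor dilute Bose gas" --star all` → 0 hits;
corpus+galaxy). `lean search 'structureFactor' --decl`: only `structureFactorVar*` API (trivial
`S ≤ N`, Lipschitz) + lattice-spin structure factors + crux skeleton stubs; `lean search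
'StaticResponse'`: crux `StaticResponseBound` family (open; STRATEGY-CENSUS §0: "the wall", deaths
D1 additive error / D2 inverse gap), no theorem. `lean find`: no stockroom hits. playbook: none fit.

## D. Why blocked (one fact)
Stub F ⟸ `BoundedGNotchedStructureFactor` (reduction proved in the evidence copy) and conversely stub F gives it with
`C = C₁/(8πa)` for `a > 0`: they are the same wall-type statement — an `O(1)`-per-mode, `N`-uniform
correlation bound for an interacting (stoquastic, notched) Bose gas at fixed small `ρ`, down to
`k = 2π/L`. No Literature decl states or implies it; printed technology (LSSY2005 Thm 2.2/2.4,
FournaisSolovej2020, YauYin2009, BastiCenatiempoSchlein2021) controls energies to LHY order with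
extensive errors only; Stringari/Pitaevskii–Stringari bounds are conditional on `χ(q)`.
-/

noncomputable section

open MeasureTheory Filter
open scoped ENNReal NNReal

namespace Summit.AtomisticToContinuum.BoseEinsteinCondensation.Theorems

open Literature.MathematicalPhysics.QuantumManyBody.BoseGas

namespace GNotch

/-! ## §1 Abstract bookkeeping: near-minimisers and the secant sandwich of `t ↦ inf (E + t·W)` -/

/-- **Near-minimisers exist** for any `ℝ≥0∞`-valued functional on a nonempty type and any slack
`δ > 0` (if the infimum is `⊤` every point qualifies). [folklore] -/
theorem exists_nearMin {ι : Type*} [Nonempty ι] (f : ι → ℝ≥0∞) {δ : ℝ≥0∞} (hδ : 0 < δ) :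
    ∃ i, f i ≤ (⨅ j, f j) + δ := by
  by_cases h : (⨅ j, f j) = ⊤
  · exact ⟨Classical.arbitrary ι, by rw [h, top_add]; exact le_top⟩
  · obtain ⟨i, hi⟩ := iInf_lt_iff.1 (ENNReal.lt_add_right h hδ.ne')
    exact ⟨i, hi.le⟩

/-- **Lower secant bound** (concavity of `g(t) = inf_Ψ (E Ψ + t·W Ψ)` in the coupling, complementary
functional `Q = Qmax - W`, additive form): if `Φ` is a `δ`-near-minimiser of `E + (r+s)·W`, then
`inf (E + r·W) + s·Qmax ≤ inf (E + (r+s)·W) + s·Q Φ + δ`; at `r = 0`, `s = t`: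
`SWITCH(t) := inf E + t·Qmax - inf F_t ≤ M_t(Φ) + δ` (`F_t = E + t·W`, `M_t = t·Q`): every
near-minimiser of the notched gas carries at least the switching energy in its mode. [folklore] -/
theorem secant_lower {S : Type*} (E W Q : S → ℝ≥0∞) (Qmax r s δ : ℝ≥0∞)
    (hWQ : ∀ Ψ, Q Ψ + W Ψ = Qmax) {Φ : S}
    (hΦ : E Φ + (r + s) * W Φ ≤ (⨅ Ψ, E Ψ + (r + s) * W Ψ) + δ) :
    (⨅ Ψ, E Ψ + r * W Ψ) + s * Qmax ≤ (⨅ Ψ, E Ψ + (r + s) * W Ψ) + s * Q Φ + δ := by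
  calc (⨅ Ψ, E Ψ + r * W Ψ) + s * Qmax ≤ (E Φ + r * W Φ) + s * (Q Φ + W Φ) := by
        gcongr
        · exact iInf_le _ Φ
        · exact (hWQ Φ).ge
    _ = (E Φ + (r + s) * W Φ) + s * Q Φ := by ring
    _ ≤ ((⨅ Ψ, E Ψ + (r + s) * W Ψ) + δ) + s * Q Φ := by gcongr
    _ = (⨅ Ψ, E Ψ + (r + s) * W Ψ) + s * Q Φ + δ := by ring

/-- **Upper secant bound**: if `Φ` is a `δ`-near-minimiser of `E + t·W`, then for every further
notch depth `s`, `inf (E + (t+s)·W) + s·Q Φ ≤ inf (E + t·W) + s·Qmax + δ`, i.e.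
`s·Q(Φ) ≤ SWITCH(t → t+s) + δ`. With `secant_lower`: `SWITCH(0→t) - δ ≤ M_t(Φ) = t·Q(Φ) ≤
(t/s)(SWITCH(t→t+s) + δ)` — stub F is an `O(ρ)`-precision statement about `t ↦ inf F_t`. [folklore] -/
theorem secant_upper {S : Type*} (E W Q : S → ℝ≥0∞) (Qmax t s δ : ℝ≥0∞)
    (hWQ : ∀ Ψ, Q Ψ + W Ψ = Qmax) {Φ : S}
    (hΦ : E Φ + t * W Φ ≤ (⨅ Ψ, E Ψ + t * W Ψ) + δ) :
    (⨅ Ψ, E Ψ + (t + s) * W Ψ) + s * Q Φ ≤ (⨅ Ψ, E Ψ + t * W Ψ) + s * Qmax + δ := by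
  calc (⨅ Ψ, E Ψ + (t + s) * W Ψ) + s * Q Φ ≤ (E Φ + (t + s) * W Φ) + s * Q Φ := by
        gcongr
        exact iInf_le _ Φ
    _ = (E Φ + t * W Φ) + s * (Q Φ + W Φ) := by ring
    _ ≤ ((⨅ Ψ, E Ψ + t * W Ψ) + δ) + s * Qmax := by
        gcongr
        exact (hWQ Φ).le
    _ = (⨅ Ψ, E Ψ + t * W Ψ) + s * Qmax + δ := by ring

/-- **The mode of a near-minimiser from a deeper-notch energy bound**: if `Φ` is a `δ`-near-minimiser
of `E + t·W` and the deeper notch costs at most `B` of switching energy,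
`inf (E + t·W) + s·Qmax ≤ inf (E + (t+s)·W) + B < ∞`, then `s · Q Φ ≤ B + δ`. [folklore] -/
theorem mode_le_of_deeper_notch {S : Type*} (E W Q : S → ℝ≥0∞) (Qmax t s δ B : ℝ≥0∞)
    (hWQ : ∀ Ψ, Q Ψ + W Ψ = Qmax) {Φ : S}
    (hΦ : E Φ + t * W Φ ≤ (⨅ Ψ, E Ψ + t * W Ψ) + δ)
    (hfin : (⨅ Ψ, E Ψ + (t + s) * W Ψ) ≠ ⊤)
    (hB : (⨅ Ψ, E Ψ + t * W Ψ) + s * Qmax ≤ (⨅ Ψ, E Ψ + (t + s) * W Ψ) + B) :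
    s * Q Φ ≤ B + δ := by
  have h := secant_upper E W Q Qmax t s δ hWQ hΦ
  have h' : (⨅ Ψ, E Ψ + (t + s) * W Ψ) + s * Q Φ ≤ (⨅ Ψ, E Ψ + (t + s) * W Ψ) + (B + δ) :=
    calc (⨅ Ψ, E Ψ + (t + s) * W Ψ) + s * Q Φ ≤ (⨅ Ψ, E Ψ + t * W Ψ) + s * Qmax + δ := h
      _ ≤ ((⨅ Ψ, E Ψ + (t + s) * W Ψ) + B) + δ := by gcongr
      _ = (⨅ Ψ, E Ψ + (t + s) * W Ψ) + (B + δ) := by ring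
  exact (ENNReal.add_le_add_iff_left hfin).1 h'

/-! ## §2 The constant state: non-vacuity and finiteness of the notched functional -/

variable {N : ℕ} {L : ℝ}

/-- `|(L³)^{-N/2}|² = ((L³)^N)⁻¹` in `ℝ≥0∞`. [folklore] -/
theorem nnnorm_constAmp_sq (N : ℕ) (hL : 0 < L) :
    ((‖((Real.sqrt ((L ^ 3) ^ N))⁻¹ : ℂ)‖₊ : ℝ≥0∞) ^ 2) = ENNReal.ofReal ((L ^ 3) ^ N)⁻¹ := by
  have hV : 0 < (L ^ 3) ^ N := by positivity
  rw [← ENNReal.coe_pow, ENNReal.ofReal, ENNReal.coe_inj]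
  ext
  rw [NNReal.coe_pow, coe_nnnorm, norm_inv, Complex.norm_real,
    Real.norm_of_nonneg (Real.sqrt_nonneg _), inv_pow, Real.sq_sqrt hV.le,
    Real.coe_toNNReal _ (by positivity)]

/-- **The constant state** `Ψ ≡ (L³)^{-N/2}` on the torus of side `L > 0`, every `N` -- adapted from
`DensityResponse.Negative.constState` (FreeChord.lean) / `PeriodicTrialState.const`. [folklore] -/
def constState (N : ℕ) (hL : 0 < L) : PeriodicTrialState N L where
  ψ _ := ((Real.sqrt ((L ^ 3) ^ N))⁻¹ : ℂ)
  contDiff := contDiff_const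
  periodic _ _ _ := rfl
  symm _ _ := rfl
  norm_eq := by
    have hV : 0 < (L ^ 3) ^ N := by positivity
    rw [setLIntegral_const, volume_cellN, nnnorm_constAmp_sq N hL, ← ENNReal.ofReal_pow hL.le,
      ← ENNReal.ofReal_pow (by positivity), ← ENNReal.ofReal_mul (by positivity),
      inv_mul_cancel₀ hV.ne', ENNReal.ofReal_one]

/-- `∫_{cell^{m+2}} v^per(x₀ - x₁) dX = (∫_{ℝ³} v) · (L³)^{m+1}` (slice integration in `x₀` and
unfolding of the periodisation on the cell). [folklore] -/
theorem lintegral_cellN_periodizedPotential_zero_one {v : ℝ → ℝ≥0∞} (hv : Measurable v)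
    (hL : 0 < L) (m : ℕ) :
    ∫⁻ X in cellN (m + 2) L, periodizedPotential v L (X 0 - X 1) =
      (∫⁻ x : Space, v ‖x‖) * (ENNReal.ofReal L ^ 3) ^ (m + 1) := by
  have hH : Measurable fun X : Config (m + 2) => periodizedPotential v L (X 0 - X 1) :=
    measurable_periodizedPotential_pair hv L 0 1
  have key := lintegral_cellN_lintegral_update (L := L) (0 : Fin (m + 2)) hH
  have hinner : ∀ X : Config (m + 2),
      (∫⁻ x in cell L, periodizedPotential v L
        (Function.update X 0 x 0 - Function.update X 0 x 1)) = ∫⁻ y : Space, v ‖y‖ := by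
    intro X
    simp only [Function.update_self, Function.update_of_ne (Fin.zero_ne_one' (n := m + 1)).symm]
    exact lintegral_cell_periodizedPotential_sub hL hv (X 1)
  simp only [hinner] at key
  rw [setLIntegral_const, volume_cellN, pow_succ _ (m + 1)] at key
  have hV0 : (ENNReal.ofReal L ^ 3) ≠ 0 := pow_ne_zero _ ((ENNReal.ofReal_pos.2 hL).ne')
  have hVt : (ENNReal.ofReal L ^ 3) ≠ ⊤ := ENNReal.pow_ne_top ENNReal.ofReal_ne_top
  rw [← ENNReal.mul_right_inj hV0 hVt, ← key]
  ring

/-- **Energy of the constant state**: `⟨Ψ_c, H Ψ_c⟩ = C(N,2) · (∫_{ℝ³} v) / L³ = ½ρ(N-1)∫v`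
(no kinetic energy; each of the `C(N,2)` pairs costs the cell average of `v^per`). [folklore] -/
theorem periodicEnergy_constState {v : ℝ → ℝ≥0∞} (hv : Measurable v) (N : ℕ) (hL : 0 < L) :
    periodicEnergy v (constState N hL) =
      ((N.choose 2 : ℕ) : ℝ≥0∞) * (∫⁻ x : Space, v ‖x‖) * (ENNReal.ofReal L ^ 3)⁻¹ := by
  have hkin : ∀ X : Config N, kineticDensity (constState N hL).ψ X = 0 := fun X => by
    simp [kineticDensity, constState]
  rcases N with _ | _ | m
  · -- no pairs
    have h0 : periodicEnergy v (constState 0 hL) = 0 := by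
      refine (lintegral_congr fun X => ?_).trans lintegral_zero
      rw [hkin, zero_add]
      simp [periodicInteraction]
    rw [h0, Nat.choose_eq_zero_of_lt (by decide : 0 < 2)]
    simp
  · -- one particle, no pairs
    have h0 : periodicEnergy v (constState (0 + 1) hL) = 0 := by
      refine (lintegral_congr fun X => ?_).trans lintegral_zero
      rw [hkin, zero_add]
      simp [periodicInteraction]
    rw [h0, Nat.choose_eq_zero_of_lt (by decide : 0 + 1 < 2)]
    simp
  · have hV0 : (ENNReal.ofReal L ^ 3) ≠ 0 := pow_ne_zero _ ((ENNReal.ofReal_pos.2 hL).ne')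
    have hVt : (ENNReal.ofReal L ^ 3) ≠ ⊤ := ENNReal.pow_ne_top ENNReal.ofReal_ne_top
    have hc : ∀ X : Config (m + 2), ((‖(constState (m + 2) hL).ψ X‖₊ : ℝ≥0∞) ^ 2) =
        ((ENNReal.ofReal L ^ 3) ^ (m + 2))⁻¹ := by
      intro X
      change ((‖((Real.sqrt ((L ^ 3) ^ (m + 2)))⁻¹ : ℂ)‖₊ : ℝ≥0∞) ^ 2) = _
      rw [nnnorm_constAmp_sq (m + 2) hL, ← ENNReal.ofReal_pow hL.le,
        ← ENNReal.ofReal_pow (by positivity), ENNReal.ofReal_inv_of_pos (by positivity)]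
    calc periodicEnergy v (constState (m + 2) hL)
        = ∫⁻ X in cellN (m + 2) L, periodicInteraction v L X * ((ENNReal.ofReal L ^ 3) ^ (m + 2))⁻¹ := by
          refine lintegral_congr fun X => ?_
          rw [hkin, zero_add, hc]
      _ = (((m + 2).choose 2 : ℕ) : ℝ≥0∞) * ∫⁻ X in cellN (m + 2) L,
            periodizedPotential v L (X 0 - X 1) * ((ENNReal.ofReal L ^ 3) ^ (m + 2))⁻¹ :=
          lintegral_cellN_periodicInteraction_mul_symm hv L measurable_const (fun _ _ => rfl)
      _ = (((m + 2).choose 2 : ℕ) : ℝ≥0∞) * ((∫⁻ x : Space, v ‖x‖) * (ENNReal.ofReal L ^ 3) ^ (m + 1) *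
            ((ENNReal.ofReal L ^ 3) ^ (m + 2))⁻¹) := by
          rw [lintegral_mul_const' _ _ (ENNReal.inv_ne_top.2 (pow_ne_zero _ hV0)),
            lintegral_cellN_periodizedPotential_zero_one hv hL m]
      _ = (((m + 2).choose 2 : ℕ) : ℝ≥0∞) * (∫⁻ x : Space, v ‖x‖) * (ENNReal.ofReal L ^ 3)⁻¹ := by
          have hsplit : ((ENNReal.ofReal L ^ 3) ^ (m + 2))⁻¹ =
              ((ENNReal.ofReal L ^ 3) ^ (m + 1))⁻¹ * (ENNReal.ofReal L ^ 3)⁻¹ := by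
            rw [pow_succ, ENNReal.mul_inv (Or.inr hVt) (Or.inl (ENNReal.pow_ne_top hVt))]
          rw [hsplit, mul_assoc, mul_assoc, ← mul_assoc ((ENNReal.ofReal L ^ 3) ^ (m + 1)),
            ENNReal.mul_inv_cancel (pow_ne_zero _ hV0) (ENNReal.pow_ne_top hVt), one_mul]

/-- The constant state has finite energy for an integrable potential. [folklore] -/
theorem periodicEnergy_constState_ne_top {v : ℝ → ℝ≥0∞} (hv : Measurable v)
    (hint : (∫⁻ x : Space, v ‖x‖) ≠ ⊤) (N : ℕ) (hL : 0 < L) :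
    periodicEnergy v (constState N hL) ≠ ⊤ := by
  rw [periodicEnergy_constState hv N hL]
  refine ENNReal.mul_ne_top (ENNReal.mul_ne_top (ENNReal.natCast_ne_top _) hint) ?_
  exact ENNReal.inv_ne_top.2 (pow_ne_zero _ ((ENNReal.ofReal_pos.2 hL).ne'))

/-- The notch term of a normalised state is at most `c⁺·2·C(N,2)` (`1 - cos ≤ 2`). [folklore] -/
theorem notchTerm_le (Ψ : PeriodicTrialState N L) (c : ℝ) (m : Fin 3 → ℤ) :
    ENNReal.ofReal c * ∫⁻ X in cellN N L, (∑ i : Fin N, ∑ j : Fin N with i < j,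
        ENNReal.ofReal (1 - Real.cos (2 * Real.pi / L * ∑ r : Fin 3, (m r : ℝ) * (X i r - X j r)))) *
        (‖Ψ.ψ X‖₊ : ℝ≥0∞) ^ 2 ≤ ENNReal.ofReal c * (((N.choose 2 : ℕ) : ℝ≥0∞) * 2) := by
  gcongr
  calc ∫⁻ X in cellN N L, (∑ i : Fin N, ∑ j : Fin N with i < j,
        ENNReal.ofReal (1 - Real.cos (2 * Real.pi / L * ∑ r : Fin 3, (m r : ℝ) * (X i r - X j r)))) *
        (‖Ψ.ψ X‖₊ : ℝ≥0∞) ^ 2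
      ≤ ∫⁻ X in cellN N L, (((N.choose 2 : ℕ) : ℝ≥0∞) * 2) * (‖Ψ.ψ X‖₊ : ℝ≥0∞) ^ 2 := by
        refine lintegral_mono fun X => ?_
        gcongr
        rw [← sum_sum_lt_const (n := N) (2 : ℝ≥0∞)]
        gcongr with i _ j _
        have hcos := Real.neg_one_le_cos (2 * Real.pi / L * ∑ r : Fin 3, (m r : ℝ) * (X i r - X j r))
        exact (ENNReal.ofReal_le_ofReal (by linarith)).trans_eq (ENNReal.ofReal_ofNat 2)
    _ = ((N.choose 2 : ℕ) : ℝ≥0∞) * 2 := by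
        rw [lintegral_const_mul' _ _ (ENNReal.mul_ne_top (ENNReal.natCast_ne_top _)
          ENNReal.ofNat_ne_top), Ψ.norm_eq, mul_one]

/-- **The notched functional is finite on the constant state** (integrable `v`, `L > 0`), hence its
infimum is finite and `δ`-near-minimisers with `δ < ∞` have finite notched energy: near-minimiser
existence in stub F is never the issue. [folklore] -/
theorem notchedF_constState_ne_top {v : ℝ → ℝ≥0∞} (hv : Measurable v)
    (hint : (∫⁻ x : Space, v ‖x‖) ≠ ⊤) (N : ℕ) (hL : 0 < L) (t : ℝ) (m : Fin 3 → ℤ) :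
    periodicEnergy v (constState N hL) + ENNReal.ofReal (2 * t / L ^ 3) *
        ∫⁻ X in cellN N L, (∑ i : Fin N, ∑ j : Fin N with i < j,
          ENNReal.ofReal (1 - Real.cos (2 * Real.pi / L * ∑ r : Fin 3, (m r : ℝ) * (X i r - X j r)))) *
          (‖(constState N hL).ψ X‖₊ : ℝ≥0∞) ^ 2 ≠ ⊤ :=
  ENNReal.add_ne_top.2 ⟨periodicEnergy_constState_ne_top hv hint N hL,
    ne_top_of_le_ne_top (ENNReal.mul_ne_top ENNReal.ofReal_ne_top
      (ENNReal.mul_ne_top (ENNReal.natCast_ne_top _) ENNReal.ofNat_ne_top))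
      (notchTerm_le (constState N hL) _ m)⟩

/-- **Trivial mode bound** `M_t(Ψ) ≤ (t/L³)·N²` (`|ρ̂_k| ≤ N`): stub F is `N² ↝ C·N`. [folklore] -/
theorem mode_le_sq (Ψ : PeriodicTrialState N L) (c : ℝ) (m : Fin 3 → ℤ) :
    ENNReal.ofReal c * ∫⁻ X in cellN N L, (‖densityWave N L m X‖₊ : ℝ≥0∞) ^ 2 *
        (‖Ψ.ψ X‖₊ : ℝ≥0∞) ^ 2 ≤ ENNReal.ofReal c * (N : ℝ≥0∞) ^ 2 := by
  gcongr
  calc ∫⁻ X in cellN N L, (‖densityWave N L m X‖₊ : ℝ≥0∞) ^ 2 * (‖Ψ.ψ X‖₊ : ℝ≥0∞) ^ 2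
      ≤ ∫⁻ X in cellN N L, (N : ℝ≥0∞) ^ 2 * (‖Ψ.ψ X‖₊ : ℝ≥0∞) ^ 2 := by
        refine lintegral_mono fun X => ?_
        gcongr
        exact nnnorm_densityWave_le L m X
    _ = (N : ℝ≥0∞) ^ 2 := by
        rw [lintegral_const_mul' _ _ (ENNReal.pow_ne_top (ENNReal.natCast_ne_top N)), Ψ.norm_eq,
          mul_one]

end GNotch

/-! ## §3 The degenerate instance `a(v) = 0` of stub F (then `t = 0`, `M ≡ 0`) -/

/-- **Stub F holds when the scattering length vanishes** (e.g. `v = 0` a.e.): then the notch coupling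
`t = 8πa = 0`, the mode functional `M` is identically `0`, and the statement reduces to the existence
of `δ`-near-minimisers of `F` on the (inhabited) periodic trial class, `GNotch.exists_nearMin`. The
signature below is the registered one with the single extra hypothesis `scatteringLength v = 0`.
[folklore] -/
theorem stub_gNotchedStructureFactor_of_scatteringLength_eq_zero : open MeasureTheory Literature.MathematicalPhysics.QuantumManyBody.BoseGas in ∀ v : ℝ → ENNReal, IsRepulsiveFiniteRange v → (∫⁻ x : EuclideanSpace ℝ (Fin 3), v ‖x‖) ≠ ⊤ → scatteringLength v = 0 → ∃ C₁ : ℝ, 0 < C₁ ∧ ∃ ρ₁ : ℝ, 0 < ρ₁ ∧ ∀ ρ : ℝ, 0 < ρ → ρ < ρ₁ → ∀ᶠ N : ℕ in Filter.atTop, ∀ L : ℝ, L = sideLength ρ N → ∀ m : Fin 3 → ℤ, m ≠ 0 → ∀ t : ℝ, t = 8 * Real.pi * (scatteringLength v).toReal → ∀ F : PeriodicTrialState N L → ENNReal, (F = fun Ψ => periodicEnergy v Ψ + ENNReal.ofReal (2 * t / L ^ 3) * ∫⁻ X in cellN N L, (∑ i : Fin N, ∑ j : Fin N with i < j, ENNReal.ofReal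 (1 - Real.cos (2 * Real.pi / L * ∑ r : Fin 3, (m r : ℝ) * (X i r - X j r)))) * (‖Ψ.ψ X‖₊ : ENNReal) ^ 2) → ∀ M : PeriodicTrialState N L → ENNReal, (M = fun Ψ => ENNReal.ofReal (t / L ^ 3) * ∫⁻ X in cellN N L, (‖densityWave N L m X‖₊ : ENNReal) ^ 2 * (‖Ψ.ψ X‖₊ : ENNReal) ^ 2) → ∀ δ : ENNReal, 0 < δ → ∃ Φ : PeriodicTrialState N L, F Φ ≤ (⨅ Ψ, F Ψ) + δ ∧ M Φ ≤ ENNReal.ofReal (C₁ * ρ) := by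
  intro v _ _ ha
  refine ⟨1, one_pos, 1, one_pos, fun ρ hρ _ => ?_⟩
  filter_upwards [eventually_ge_atTop 1] with N hN
  intro L hL m _ t ht F _ M hM δ hδ
  have hLpos : 0 < L := by
    rw [hL]
    exact Real.rpow_pos_of_pos (div_pos (Nat.cast_pos.2 hN) hρ) _
  haveI : Nonempty (PeriodicTrialState N L) := ⟨GNotch.constState N hLpos⟩
  obtain ⟨Φ, hΦ⟩ := GNotch.exists_nearMin F hδ
  refine ⟨Φ, hΦ, ?_⟩
  have ht0 : t = 0 := by rw [ht, ha, ENNReal.toReal_zero, mul_zero]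
  rw [hM, ht0, zero_div, ENNReal.ofReal_zero]
  simp

end Summit.AtomisticToContinuum.BoseEinsteinCondensation.Theorems
end
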